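import Summits.HubbardSuperconductivity.HubbardSuperconductivity.Theorems.AnisotropyChordTransferFibre3Hole2Quarter

/-!
# Route `AnisotropyChord` / H0 rotor rung: ★ HOLE₂(.75) AT `L = 13` — `TwoHoleGap 13 (3/4·eps1 13)`

The one-body spectral input of the GM₃ assembly `gm3_of_hole2` (p1 g23) at side length `L = 13`: the Neumann gap of the rate-½ walk
on the `13 × 13` torus with ANY two vertices deleted is at least `¾ε₁(13)`.  KERNEL CERTIFICATE, ZERO DATA: the quarter-table interval
Birman–Schwinger checker `Hole2.checkRepsQ` (`…Fibre3Hole2Quarter`: separable Green table on `0 ≤ r₁,r₂ ≤ L/2`, fixed-point Gauss–Jordan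
charge map, exact Schur positivity test) accepts the 27 `D₄`-classes of separations `0 ≤ y ≤ x ≤ 6` (one `decide +kernel`), and the classes
cover every nonzero separation (`decide +kernel`); soundness is `Hole2.twoHoleGap_of_checkRepsQ` (resting on p2's PROP BS `…Fibre3TwoHoleBS`
and p1's reductions `…Fibre3TwoHoleGapReduce`).  Python mirror (prover's folder `scratch/fixcert.py`): all classes pass for every
`9 ≤ L ≤ 32`; the same test fails just above the true gap (`L = 8`: `.737ε₁`; `L = 9`: `.774ε₁`).
Prover seat `hubbard-h0-rotor-p3` g3; helper for stmt-HubbardSuperconductivity-19089 (`--supports`, helper class).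
WHAT THIS IS NOT: nothing here proves superconductivity in the Hubbard model (rotor TARGET as worded stays FALSE, g15 verdict); this
discharges, at ONE side length, ONE hypothesis (HOLE₂(.75)) of ONE conditional reduction (rung 19089); the three β-free cruxes, `mHole ≥ 0`
and the side condition of `gm3_of_hole2` are untouched. Tree imports only; no sorry, no axioms, no `native_decide`.
-/

set_option linter.dupNamespace false
set_option autoImplicit false

namespace Summit.HubbardSuperconductivity.HubbardSuperconductivity.Theorems.AnisotropyChord.Transfer.Fibre3

namespace Hole2

/-- the 27 `D₄`-representatives of the nonzero separations of the `13 × 13` torus. [folklore] -/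
def reps13 : List (ℕ × ℕ) := [(1, 0), (1, 1), (2, 0), (2, 1), (2, 2), (3, 0), (3, 1), (3, 2), (3, 3), (4, 0), (4, 1), (4, 2), (4, 3), (4, 4), (5, 0), (5, 1), (5, 2), (5, 3), (5, 4), (5, 5), (6, 0), (6, 1), (6, 2), (6, 3), (6, 4), (6, 5), (6, 6)]

/-- kernel fact: every representative passes the quarter-table interval Birman–Schwinger test at `g_13 ≥ ¾ε₁(13)`. [folklore] -/
theorem checkRepsQ_13 : checkRepsQ 13 reps13 = true := by
  decide +kernel

/-- the representatives meet the `D₄`-orbit of every nonzero separation (finite check). [folklore] -/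
theorem cover_13 : ∀ z : Tor 13, z ≠ 0 → ∃ s ∈ (reps13.map fun ab => sT 13 ab.1 ab.2).toFinset, s ∈ d4Orbit 13 z := by
  decide +kernel

/-- ★★★ HOLE₂(.75) AT `L = 13`: `TwoHoleGap 13 (3/4 * eps1 13)`, the spectral hypothesis of `gm3_of_hole2` at `L = 13`. [folklore] -/
theorem twoHoleGap_thirteen : TwoHoleGap 13 (3 / 4 * eps1 13) :=
  twoHoleGap_of_checkRepsQ 13 reps13 checkRepsQ_13 cover_13

end Hole2

end Summit.HubbardSuperconductivity.HubbardSuperconductivity.Theorems.AnisotropyChord.Transfer.Fibre3
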